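import Mathlib
import Summits.NavierStokesRegularity.NavierStokesRegularity.Theorems.EulerZoomLiouvillePowerGaugeEulerLiouvilleWeakEtaMollified
import HarnessLib

/-!
# Crux `EulerZoomLiouville.PowerGaugeEulerLiouville` (stmt-NavierStokesRegularity-19832), weak stratum, line `weak_eulerian` (E2):
# THE MOLLIFIED TRANSPORT EQUATION WITH A SOURCE AND ITS COMMUTATOR — scalar form and the components of a vector unknown

Route №10 `EulerZoomLiouville` (NavierStokesRegularity), crux E = stmt-NavierStokesRegularity-19832; width seat ns-ezl-w2 g7 under the LEAD ns-typeII-p2.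
First brick of `stub_renormalisation` (E2, the DiPerna–Lions renormalisation of the weak vorticity equation
`div(W ⊗ Ω) = (3γ−1)Ω + GΩ`).  Two class-free facts of first-order weak calculus:

* `fderiv_convolution_apply_transport_eq_source` — SCALAR transport WITH A SOURCE: if `∫ η Dψ[W] = ∫ ψ g` for every test `ψ`
  (`div(Wη) = −g` in `𝒟′`, `η ∈ L¹_loc`, `η‖W‖ ∈ L¹_loc`), then for every test kernel `φ` and EVERY `x`
  `D(φ ⋆ η)(x)[W x] = (∫ η(y) Dφ(x−y)[W x − W y] dy) − (φ ⋆ g)(x)`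
  (the tree's `WeakAxisym.fderiv_convolution_apply_transport_eq` is the case `g = (1−2γ)η`);
* components of a VECTOR unknown `Θ : ℝ³ → ℝ³`: `⟪(φ ⋆ Θ)(x), e⟫ = (φ ⋆ ⟪Θ, e⟫)(x)` (`inner_convolution_eq`),
  `⟪D(φ ⋆ Θ)(x)[w], e⟫ = D(φ ⋆ ⟪Θ, e⟫)(x)[w]` (`inner_fderiv_convolution_apply`), hence the COMPONENT IDENTITY
  `inner_fderiv_convolution_apply_transport_eq`: if `∫ ⟪Θ, e⟫ Dψ[W] = ∫ ψ ⟪S, e⟫` for all tests, then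
  `⟪D(φ ⋆ Θ)(x)[W x], e⟫ = (∫ ⟪Θ y, e⟫ Dφ(x−y)[W x − W y] dy) − ∫ φ(x−y)⟪S y, e⟫ dy`.

The first integral is the DiPerna–Lions commutator in the currency of the tree's local commutator lemma
`Literature.Analysis.FunctionSpaces.tendsto_setLIntegral_gradCommutator'` (p708958).
[folklore; DiPernaLions1989 §II.1 (proof of Thm. II.1); Evans2010 App. C.4]

WHAT THIS IS NOT: not NS, not E, not E2 yet (the renormalisation limit is the next files); 19832 is OPEN.
-/

noncomputable section

-- flat `Theorems/<Route><Decl>…` files of one crux share the namespace of the crux (tree convention)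
set_option linter.dupNamespace false

open MeasureTheory Set Filter Topology Metric Function TopologicalSpace ContinuousLinearMap
open scoped ENNReal NNReal RealInnerProductSpace ContDiff Convolution

namespace Summit.NavierStokesRegularity.NavierStokesRegularity.Theorems.PowerGaugeEulerLiouville.WeakEulerian

open Literature.Analysis Literature.Analysis.FunctionSpaces Literature.Analysis.FluidPDE
open Summit.NavierStokesRegularity.NavierStokesRegularity.Theorems.PowerGaugeEulerLiouville

section Scalar

variable {W : EuclideanSpace ℝ (Fin 3) → EuclideanSpace ℝ (Fin 3)} {η g : EuclideanSpace ℝ (Fin 3) → ℝ}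
  {φ : EuclideanSpace ℝ (Fin 3) → ℝ}

/-- **THE MOLLIFIED TRANSPORT EQUATION WITH A SOURCE AND ITS COMMUTATOR (scalar).**  If `∫ η Dψ[W] = ∫ ψ g` for every test `ψ`
(`div(Wη) = −g` in `𝒟′`), then for every test kernel `φ` and EVERY `x`:
`D(φ ⋆ η)(x)[W x] = (∫ η(y) Dφ(x−y)[W x − W y] dy) − (φ ⋆ g)(x)` (test the equation with `φ(x − ·)`).
[folklore; DiPernaLions1989 §II.1] -/
theorem fderiv_convolution_apply_transport_eq_source (hη : LocallyIntegrable η volume) (hWm : AEStronglyMeasurable W volume)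
    (hηW : LocallyIntegrable (fun y => η y * ‖W y‖) volume)
    (hφ : IsTestFunctionOn (⊤ : Opens (EuclideanSpace ℝ (Fin 3))) φ)
    (heq : ∀ ψ : EuclideanSpace ℝ (Fin 3) → ℝ, IsTestFunctionOn (⊤ : Opens (EuclideanSpace ℝ (Fin 3))) ψ →
      ∫ y, η y * fderiv ℝ ψ y (W y) = ∫ y, ψ y * g y) (x : EuclideanSpace ℝ (Fin 3)) :
    fderiv ℝ (φ ⋆[lsmul ℝ ℝ, volume] η) x (W x) =
      (∫ y, η y * fderiv ℝ φ (x - y) (W x - W y)) - (φ ⋆[lsmul ℝ ℝ, volume] g) x := by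
  have hφ1 : ContDiff ℝ 1 φ := hφ.contDiff.of_le (by exact_mod_cast le_top)
  -- the equation tested with `φ(x − ·)`
  have h1 : ∫ y, η y * fderiv ℝ φ (x - y) (W y) = -((φ ⋆[lsmul ℝ ℝ, volume] g) x) := by
    have h := heq (fun y => φ (x - y)) (hφ.comp_sub_left x)
    simp_rw [fderiv_comp_sub_left_apply hφ1, mul_neg, integral_neg] at h
    rw [WeakAxisym.convolution_lsmul_eq_integral]
    linarith
  -- the `W x` half is the derivative of the mollification
  have h2 : ∫ y, η y * fderiv ℝ φ (x - y) (W x) = fderiv ℝ (φ ⋆[lsmul ℝ ℝ, volume] η) x (W x) := by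
    rw [WeakAxisym.fderiv_convolution_lsmul_apply_eq_integral hη hφ]
    exact integral_congr_ae (Eventually.of_forall fun y => mul_comm _ _)
  have i1 := WeakAxisym.integrable_mul_fderiv_comp_sub_apply_const hη hφ x (W x)
  have i2 := WeakAxisym.integrable_mul_fderiv_comp_sub_apply hη.aestronglyMeasurable hWm hηW hφ x
  have hsplit : ∫ y, η y * fderiv ℝ φ (x - y) (W x - W y) =
      (∫ y, η y * fderiv ℝ φ (x - y) (W x)) - ∫ y, η y * fderiv ℝ φ (x - y) (W y) := by
    rw [← integral_sub i1 i2]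
    refine integral_congr_ae (Eventually.of_forall fun y => ?_)
    simp only [map_sub, mul_sub]
  rw [hsplit, h1, h2]
  ring

end Scalar

section Components

variable {F : Type*} [NormedAddCommGroup F] [InnerProductSpace ℝ F] [CompleteSpace F]
variable {Θ : EuclideanSpace ℝ (Fin 3) → F} {φ : EuclideanSpace ℝ (Fin 3) → ℝ}

/-- **Components commute with mollification**: `⟪(φ ⋆ Θ)(x), e⟫ = (φ ⋆ ⟪Θ, e⟫)(x)` (for `Θ ∈ L¹_loc` and a continuous compactly supported
kernel, so that the convolution integral converges). [folklore; Evans2010 App. C.4] -/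
theorem inner_convolution_eq (hΘ : LocallyIntegrable Θ volume) (hφc : Continuous φ) (hφs : HasCompactSupport φ)
    (x : EuclideanSpace ℝ (Fin 3)) (e : F) :
    ⟪(φ ⋆[lsmul ℝ ℝ, volume] Θ) x, e⟫ = (φ ⋆[lsmul ℝ ℝ, volume] fun y => ⟪Θ y, e⟫) x := by
  rw [convolution_def, convolution_def]
  have hint : Integrable (fun t => (lsmul ℝ ℝ) (φ t) (Θ (x - t))) volume :=
    (hφs.convolutionExists_left (lsmul ℝ ℝ : ℝ →L[ℝ] F →L[ℝ] F) hφc hΘ x).integrable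
  rw [real_inner_comm, ← integral_inner hint e]
  refine integral_congr_ae (Eventually.of_forall fun t => ?_)
  simp only [lsmul_apply, inner_smul_right, real_inner_comm, smul_eq_mul]

omit [CompleteSpace F] in
/-- The mollification of a locally integrable vector field is `C¹` (indeed smooth). [folklore; Evans2010 App. C.4 Thm. 7] -/
theorem contDiff_convolution_of_test (hΘ : LocallyIntegrable Θ volume)
    (hφ : IsTestFunctionOn (⊤ : Opens (EuclideanSpace ℝ (Fin 3))) φ) {n : ℕ∞} :
    ContDiff ℝ n (φ ⋆[lsmul ℝ ℝ, volume] Θ) :=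
  hφ.hasCompactSupport.contDiff_convolution_left _ (hφ.contDiff.of_le (by exact_mod_cast le_top)) hΘ

/-- **Components commute with the derivative of the mollification**: `⟪D(φ ⋆ Θ)(x)[w], e⟫ = D(φ ⋆ ⟪Θ, e⟫)(x)[w]`.
[folklore; Evans2010 App. C.4] -/
theorem inner_fderiv_convolution_apply (hΘ : LocallyIntegrable Θ volume)
    (hφ : IsTestFunctionOn (⊤ : Opens (EuclideanSpace ℝ (Fin 3))) φ) (x w : EuclideanSpace ℝ (Fin 3)) (e : F) :
    ⟪fderiv ℝ (φ ⋆[lsmul ℝ ℝ, volume] Θ) x w, e⟫ = fderiv ℝ (φ ⋆[lsmul ℝ ℝ, volume] fun y => ⟪Θ y, e⟫) x w := by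
  have hfun : (φ ⋆[lsmul ℝ ℝ, volume] fun y => ⟪Θ y, e⟫) = fun z => ⟪(φ ⋆[lsmul ℝ ℝ, volume] Θ) z, e⟫ :=
    funext fun z => (inner_convolution_eq hΘ hφ.contDiff.continuous hφ.hasCompactSupport z e).symm
  have hd : DifferentiableAt ℝ (φ ⋆[lsmul ℝ ℝ, volume] Θ) x :=
    ((contDiff_convolution_of_test hΘ hφ (n := 1)).differentiable (by simp)) x
  rw [hfun, fderiv_inner_apply ℝ hd (differentiableAt_const e), fderiv_const_apply]
  simp

variable {W S : EuclideanSpace ℝ (Fin 3) → EuclideanSpace ℝ (Fin 3)} {Ω : EuclideanSpace ℝ (Fin 3) → EuclideanSpace ℝ (Fin 3)}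

/-- `|⟪Θ, e⟫|‖W‖ ∈ L¹_loc` from `‖Θ‖‖W‖ ∈ L¹_loc`. [folklore] -/
theorem locallyIntegrable_inner_mul_norm (hΩm : AEStronglyMeasurable Ω volume) (hWm : AEStronglyMeasurable W volume)
    (hΩW : LocallyIntegrable (fun y => ‖Ω y‖ * ‖W y‖) volume) (e : EuclideanSpace ℝ (Fin 3)) :
    LocallyIntegrable (fun y => ⟪Ω y, e⟫ * ‖W y‖) volume := by
  have hm : AEStronglyMeasurable (fun y => ⟪Ω y, e⟫ * ‖W y‖) volume := (hΩm.inner aestronglyMeasurable_const).mul hWm.norm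
  refine fun z => ?_
  obtain ⟨U, hU, hint⟩ := hΩW z
  refine ⟨U, hU, (hint.const_mul ‖e‖).mono' hm.restrict (Eventually.of_forall fun y => ?_)⟩
  rw [norm_mul, norm_norm]
  calc ‖⟪Ω y, e⟫‖ * ‖W y‖ ≤ ‖Ω y‖ * ‖e‖ * ‖W y‖ := mul_le_mul_of_nonneg_right (norm_inner_le_norm _ _) (norm_nonneg _)
    _ = ‖e‖ * (‖Ω y‖ * ‖W y‖) := by ring

/-- **THE COMPONENT IDENTITY of the mollified vector transport equation with a source.**  If `∫ ⟪Ω, e⟫ Dψ[W] = ∫ ψ ⟪S, e⟫` for every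
test `ψ` (`Ω ∈ L¹_loc`, `‖Ω‖‖W‖ ∈ L¹_loc`), then for every test kernel `φ` and every `x`:
`⟪D(φ ⋆ Ω)(x)[W x], e⟫ = (∫ ⟪Ω y, e⟫ Dφ(x−y)[W x − W y] dy) − ∫ φ(x−y) ⟪S y, e⟫ dy`.
[folklore; DiPernaLions1989 §II.1] -/
theorem inner_fderiv_convolution_apply_transport_eq (hΩ : LocallyIntegrable Ω volume) (hWm : AEStronglyMeasurable W volume)
    (hΩW : LocallyIntegrable (fun y => ‖Ω y‖ * ‖W y‖) volume)
    (hφ : IsTestFunctionOn (⊤ : Opens (EuclideanSpace ℝ (Fin 3))) φ) (e : EuclideanSpace ℝ (Fin 3))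
    (heq : ∀ ψ : EuclideanSpace ℝ (Fin 3) → ℝ, IsTestFunctionOn (⊤ : Opens (EuclideanSpace ℝ (Fin 3))) ψ →
      ∫ y, ⟪Ω y, e⟫ * fderiv ℝ ψ y (W y) = ∫ y, ψ y * ⟪S y, e⟫) (x : EuclideanSpace ℝ (Fin 3)) :
    ⟪fderiv ℝ (φ ⋆[lsmul ℝ ℝ, volume] Ω) x (W x), e⟫ =
      (∫ y, ⟪Ω y, e⟫ * fderiv ℝ φ (x - y) (W x - W y)) - ∫ y, φ (x - y) * ⟪S y, e⟫ := by
  have hη : LocallyIntegrable (fun y => ⟪Ω y, e⟫) volume :=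
    (hΩ.smul ‖e‖).mono (hΩ.aestronglyMeasurable.inner aestronglyMeasurable_const)
      (Eventually.of_forall fun y => by
        rw [Pi.smul_apply, norm_smul, norm_norm, mul_comm]
        exact norm_inner_le_norm _ _)
  have hηW := locallyIntegrable_inner_mul_norm hΩ.aestronglyMeasurable hWm hΩW e
  have h := fderiv_convolution_apply_transport_eq_source (η := fun y => ⟪Ω y, e⟫) (g := fun y => ⟪S y, e⟫)
    hη hWm hηW hφ heq x
  rw [inner_fderiv_convolution_apply hΩ hφ x (W x) e, h, WeakAxisym.convolution_lsmul_eq_integral]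

end Components

end Summit.NavierStokesRegularity.NavierStokesRegularity.Theorems.PowerGaugeEulerLiouville.WeakEulerian

end
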